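import Mathlib.Analysis.Calculus.SmoothSeries
import Mathlib.Analysis.SpecialFunctions.Exponential
import Mathlib.Analysis.SpecificLimits.Normed
import Mathlib.Analysis.SpecialFunctions.Log.Deriv
import HarnessLib

/-!
# Power series in `log x`: the calculus behind `Li(x^z) = Σ zⁿ(log x)ⁿ/(n·n!)` and `li(x^z)`

Topic `Literature/NumberTheory/BeurlingPrimes`. Everything in this file is PROVED.

Broucke–Debruyne–Révész (2023, §2) work with the logarithmic integrals through their expansions in powers
of `log x`:
`Li(x) = ∫₁ˣ (1 − u⁻¹)/log u du = Σ_{n≥1} (log x)ⁿ/(n·n!)` (2.1),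
`li(x) = Σ_{k≥1} (μ(k)/k) Li(x^{1/k}) = Σ_{n≥1} (log x)ⁿ/(n·n!·ζ(n+1))` (2.2),
`Li(x^z) = Σ_{n≥1} zⁿ(log x)ⁿ/(n·n!)`, `li(x^z) = Σ_{n≥1} zⁿ(log x)ⁿ/(n·n!·ζ(n+1))` (2.3)–(2.4), and the
termwise derivative `x log x (d/dx) li(x^z) = Σ_{n≥1} zⁿ(log x)ⁿ/(n!ζ(n+1))` (2.6) ("the series expansion
converges locally uniformly"; "obtained by termwise differentiation").

This file provides that calculus once and for all for a general coefficient sequence: for `c : ℕ → ℝ` of at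
most geometric growth (`|c n| ≤ A Rⁿ`),

  `logSeries c L = Σ_{n ≥ 0} c n · Lⁿ/n!`   (an entire function of `L = log x`),

with: absolute convergence (`summable_logSeries_abs`), the value at `0`, the **termwise derivative**
`(logSeries c)' = logSeries (n ↦ c (n+1))` (`hasDerivAt_logSeries`, via Mathlib's
`hasDerivAt_tsum_of_isPreconnected`), continuity, sign and comparison lemmas, and the two closed forms
`logSeries (zⁿ) L = e^{zL}` and `L · logSeries (z^{n+1}/(n+1)) L = e^{zL} − 1` (the latter is
`x log x · (d/dx) Li(x^z) = x^z − 1`, BDR (2.5) with `μ` replaced by the trivial character).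

## References
* [BrouckeDebruyneRevesz2023] F. Broucke, G. Debruyne, Sz. Gy. Révész, *Some examples of well-behaved Beurling
  number systems*, arXiv:2309.01567, §2 (2.1)–(2.7) (read).
-/

noncomputable section

open Filter Set Real
open scoped Topology Nat

namespace Literature.NumberTheory.BeurlingPrimes

/-- The **power series in `L = log x`** with coefficients `c n / n!`:
`logSeries c L = Σ_{n ≥ 0} c n · Lⁿ / n!` (e.g. `c n = zⁿ/n` (`n ≥ 1`), `c 0 = 0` gives `Li(x^z)` at
`L = log x`, BDR (2.3)). [cite: BrouckeDebruyneRevesz2023, §2 (2.1)–(2.4)] -/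
def logSeries (c : ℕ → ℝ) (L : ℝ) : ℝ :=
  ∑' n : ℕ, c n * L ^ n / n !

variable {c d : ℕ → ℝ} {A R : ℝ}

/-! ### Convergence -/

/-- Absolute convergence: `|c n Lⁿ/n!| ≤ A (R|L|)ⁿ/n!` is summable. [folklore] -/
theorem summable_logSeries_abs (hA : 0 ≤ A) (hc : ∀ n, |c n| ≤ A * R ^ n) (L : ℝ) :
    Summable fun n ↦ |c n * L ^ n / n !| := by
  have hR : ∀ n, 0 ≤ A * R ^ n := fun n ↦ (abs_nonneg _).trans (hc n)
  refine Summable.of_nonneg_of_le (fun n ↦ abs_nonneg _) (fun n ↦ ?_)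
    ((Real.summable_pow_div_factorial (|R| * |L|)).mul_left A)
  have hcn : |c n| ≤ A * |R| ^ n := (hc n).trans (by
    rw [← abs_pow]; exact mul_le_mul_of_nonneg_left (le_abs_self _) hA)
  have habs : |c n * L ^ n / n !| = |c n| * (|L| ^ n / n !) := by
    rw [abs_div, abs_mul, abs_pow, Nat.abs_cast, mul_div_assoc]
  rw [habs]
  calc |c n| * (|L| ^ n / n !) ≤ A * |R| ^ n * (|L| ^ n / n !) := mul_le_mul_of_nonneg_right hcn (by positivity)
    _ = A * ((|R| * |L|) ^ n / n !) := by rw [mul_pow]; ring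

/-- The terms of `logSeries c L` are summable. [folklore] -/
theorem summable_logSeries (hA : 0 ≤ A) (hc : ∀ n, |c n| ≤ A * R ^ n) (L : ℝ) :
    Summable fun n ↦ c n * L ^ n / n ! :=
  (summable_abs_iff.1 (summable_logSeries_abs hA hc L))

/-- `HasSum` form of the definition. [folklore] -/
theorem hasSum_logSeries (hA : 0 ≤ A) (hc : ∀ n, |c n| ≤ A * R ^ n) (L : ℝ) :
    HasSum (fun n ↦ c n * L ^ n / n !) (logSeries c L) :=
  (summable_logSeries hA hc L).hasSum

/-- A geometric bound for the shifted sequence `n ↦ c (n+1)`: `|c (n+1)| ≤ (A|R|) |R|ⁿ`. [folklore] -/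
theorem shift_bound (hA : 0 ≤ A) (hc : ∀ n, |c n| ≤ A * R ^ n) (n : ℕ) :
    |c (n + 1)| ≤ A * |R| * |R| ^ n := by
  calc |c (n + 1)| ≤ A * R ^ (n + 1) := hc (n + 1)
    _ ≤ A * |R| ^ (n + 1) := by
        rw [← abs_pow]; exact mul_le_mul_of_nonneg_left (le_abs_self _) hA
    _ = A * |R| * |R| ^ n := by ring

/-- `logSeries c 0 = c 0`. [folklore] -/
theorem logSeries_zero (c : ℕ → ℝ) : logSeries c 0 = c 0 := by
  unfold logSeries
  rw [tsum_eq_single 0]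
  · simp
  · intro n hn
    simp [zero_pow hn]

/-! ### Termwise differentiation -/

/-- **Termwise derivative**: `(d/dL) Σ c n Lⁿ/n! = Σ c (n+1) Lⁿ/n!` (BDR (2.6): "obtained by termwise
differentiation"). [cite: BrouckeDebruyneRevesz2023, §2 (2.6)] -/
theorem hasDerivAt_logSeries (hA : 0 ≤ A) (hc : ∀ n, |c n| ≤ A * R ^ n) (L : ℝ) :
    HasDerivAt (logSeries c) (logSeries (fun n ↦ c (n + 1)) L) L := by
  -- work on the bounded open interval `(-M, M)`, `M = |L| + 1`
  set M : ℝ := |L| + 1 with hM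
  have hM0 : 0 < M := by positivity
  have hLM : L ∈ Ioo (-M) M := by
    constructor <;> [linarith [neg_abs_le L]; linarith [le_abs_self L]]
  set g : ℕ → ℝ → ℝ := fun n y ↦ c n * y ^ n / n ! with hg
  set g' : ℕ → ℝ → ℝ := fun n y ↦ c n * (n * y ^ (n - 1)) / n ! with hg'
  set u : ℕ → ℝ := fun n ↦ |c n| * (n * M ^ (n - 1)) / n ! with hu
  have hderiv : ∀ n y, y ∈ Ioo (-M) M → HasDerivAt (g n) (g' n y) y := fun n y _ ↦
    ((hasDerivAt_pow n y).const_mul (c n)).div_const _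
  have hbound : ∀ n y, y ∈ Ioo (-M) M → ‖g' n y‖ ≤ u n := by
    intro n y hy
    have hyM : |y| ≤ M := abs_le.2 ⟨hy.1.le, hy.2.le⟩
    simp only [hg', hu, Real.norm_eq_abs, abs_div, abs_mul, Nat.abs_cast, abs_pow]
    refine div_le_div_of_nonneg_right ?_ (by positivity)
    refine mul_le_mul_of_nonneg_left ?_ (abs_nonneg _)
    exact mul_le_mul_of_nonneg_left (pow_le_pow_left₀ (abs_nonneg _) hyM _) (Nat.cast_nonneg _)
  -- summability of the bound: `u (n+1) = (A|R|)·(|R|M)ⁿ/n!`-dominated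
  have husum : Summable u := by
    rw [← summable_nat_add_iff 1]
    have hmaj : Summable fun n : ℕ ↦ A * |R| * ((|R| * M) ^ n / n !) :=
      (Real.summable_pow_div_factorial (|R| * M)).mul_left (A * |R|)
    refine Summable.of_nonneg_of_le (fun n ↦ by simp only [hu]; positivity) (fun n ↦ ?_) hmaj
    simp only [hu, Nat.add_sub_cancel, Nat.factorial_succ, Nat.cast_mul, Nat.cast_add, Nat.cast_one]
    have hfac : (0 : ℝ) < n ! := by positivity
    have hn1 : (0 : ℝ) < n + 1 := by positivity
    rw [div_le_iff₀ (by positivity), mul_pow]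
    have h1 : |c (n + 1)| ≤ A * |R| * |R| ^ n := shift_bound hA hc n
    have h2 : 0 ≤ M ^ n := by positivity
    calc |c (n + 1)| * ((n + 1 : ℝ) * M ^ n) ≤ A * |R| * |R| ^ n * ((n + 1 : ℝ) * M ^ n) :=
          mul_le_mul_of_nonneg_right h1 (by positivity)
      _ = A * |R| * (|R| ^ n * M ^ n / n !) * ((n + 1 : ℝ) * n !) := by field_simp
  have hsum0 : Summable fun n ↦ g n L := summable_logSeries hA hc L
  have H := hasDerivAt_tsum_of_isPreconnected husum isOpen_Ioo isPreconnected_Ioo hderiv hbound hLM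
    hsum0 hLM
  -- identify the derivative series with `logSeries (c ∘ succ) L`
  have hval : ∑' n, g' n L = logSeries (fun n ↦ c (n + 1)) L := by
    have hs' : Summable fun n ↦ g' n L :=
      Summable.of_norm_bounded husum (fun n ↦ hbound n L hLM)
    rw [hs'.tsum_eq_zero_add]
    simp only [hg', logSeries, Nat.cast_zero, zero_mul, mul_zero, zero_div, zero_add, Nat.add_sub_cancel,
      Nat.factorial_succ, Nat.cast_mul, Nat.cast_add, Nat.cast_one]
    refine tsum_congr fun n ↦ ?_
    have hfac : (n ! : ℝ) ≠ 0 := by positivity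
    have hn1 : (n : ℝ) + 1 ≠ 0 := by positivity
    field_simp
  rw [hval] at H
  exact H

/-- `logSeries c` is differentiable, hence continuous. [folklore] -/
theorem continuous_logSeries (hA : 0 ≤ A) (hc : ∀ n, |c n| ≤ A * R ^ n) : Continuous (logSeries c) :=
  continuous_iff_continuousAt.2 fun L ↦ (hasDerivAt_logSeries hA hc L).continuousAt

/-- Chain rule: `(d/dy) logSeries c (log y) = logSeries (c ∘ succ) (log y) · y⁻¹` for `y ≠ 0`.
[cite: BrouckeDebruyneRevesz2023, §2 (2.6)] -/
theorem hasDerivAt_logSeries_log (hA : 0 ≤ A) (hc : ∀ n, |c n| ≤ A * R ^ n) {y : ℝ} (hy : y ≠ 0) :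
    HasDerivAt (fun y ↦ logSeries c (Real.log y)) (logSeries (fun n ↦ c (n + 1)) (Real.log y) * y⁻¹) y :=
  (hasDerivAt_logSeries hA hc (Real.log y)).comp y (Real.hasDerivAt_log hy)

/-! ### Sign and comparison -/

/-- Non-negative coefficients and `L ≥ 0` give a non-negative sum. [folklore] -/
theorem logSeries_nonneg (hc0 : ∀ n, 0 ≤ c n) {L : ℝ} (hL : 0 ≤ L) : 0 ≤ logSeries c L :=
  tsum_nonneg fun n ↦ by have := hc0 n; positivity

/-- The sum dominates each term (non-negative coefficients, `L ≥ 0`). [folklore] -/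
theorem term_le_logSeries (hA : 0 ≤ A) (hc : ∀ n, |c n| ≤ A * R ^ n) (hc0 : ∀ n, 0 ≤ c n) {L : ℝ}
    (hL : 0 ≤ L) (n : ℕ) : c n * L ^ n / n ! ≤ logSeries c L :=
  (summable_logSeries hA hc L).le_tsum n fun m _ ↦ by have := hc0 m; positivity

/-- Monotonicity in the coefficients (`L ≥ 0`). [folklore] -/
theorem logSeries_le_logSeries {B S : ℝ} (hA : 0 ≤ A) (hc : ∀ n, |c n| ≤ A * R ^ n) (hB : 0 ≤ B)
    (hd : ∀ n, |d n| ≤ B * S ^ n) (hcd : ∀ n, c n ≤ d n) {L : ℝ} (hL : 0 ≤ L) :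
    logSeries c L ≤ logSeries d L :=
  Summable.tsum_le_tsum (fun n ↦ by
      have := hcd n
      exact div_le_div_of_nonneg_right (mul_le_mul_of_nonneg_right this (by positivity)) (by positivity))
    (summable_logSeries hA hc L) (summable_logSeries hB hd L)

/-- `|logSeries c L| ≤ logSeries d |L|` whenever `|c n| ≤ d n`. [folklore] -/
theorem abs_logSeries_le {B S : ℝ} (hA : 0 ≤ A) (hc : ∀ n, |c n| ≤ A * R ^ n) (hB : 0 ≤ B)
    (hd : ∀ n, |d n| ≤ B * S ^ n) (hcd : ∀ n, |c n| ≤ d n) (L : ℝ) :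
    |logSeries c L| ≤ logSeries d |L| := by
  unfold logSeries
  have h1 : ‖(∑' n, c n * L ^ n / n ! : ℝ)‖ ≤ ∑' n, ‖(c n * L ^ n / n ! : ℝ)‖ :=
    norm_tsum_le_tsum_norm (summable_logSeries_abs hA hc L)
  simp only [Real.norm_eq_abs] at h1
  refine h1.trans ?_
  refine Summable.tsum_le_tsum (fun n ↦ ?_) (summable_logSeries_abs hA hc L) (summable_logSeries hB hd |L|)
  rw [abs_div, abs_mul, abs_pow, Nat.abs_cast]
  exact div_le_div_of_nonneg_right (mul_le_mul_of_nonneg_right (hcd n) (by positivity)) (by positivity)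

/-- Monotonicity in `L` on `[0, ∞)` for non-negative coefficients. [folklore] -/
theorem logSeries_mono (hA : 0 ≤ A) (hc : ∀ n, |c n| ≤ A * R ^ n) (hc0 : ∀ n, 0 ≤ c n) {L₁ L₂ : ℝ}
    (hL₁ : 0 ≤ L₁) (hL : L₁ ≤ L₂) : logSeries c L₁ ≤ logSeries c L₂ :=
  Summable.tsum_le_tsum (fun n ↦ by
      have := hc0 n
      exact div_le_div_of_nonneg_right
        (mul_le_mul_of_nonneg_left (pow_le_pow_left₀ hL₁ hL n) this) (by positivity))
    (summable_logSeries hA hc L₁) (summable_logSeries hA hc L₂)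

/-! ### Linearity -/

/-- `logSeries (c + d) = logSeries c + logSeries d`. [folklore] -/
theorem logSeries_add {B S : ℝ} (hA : 0 ≤ A) (hc : ∀ n, |c n| ≤ A * R ^ n) (hB : 0 ≤ B)
    (hd : ∀ n, |d n| ≤ B * S ^ n) (L : ℝ) :
    logSeries (fun n ↦ c n + d n) L = logSeries c L + logSeries d L := by
  unfold logSeries
  rw [← (summable_logSeries hA hc L).tsum_add (summable_logSeries hB hd L)]
  exact tsum_congr fun n ↦ by ring

/-- `logSeries (a • c) = a · logSeries c`. [folklore] -/
theorem logSeries_const_mul (a : ℝ) (c : ℕ → ℝ) (L : ℝ) :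
    logSeries (fun n ↦ a * c n) L = a * logSeries c L := by
  unfold logSeries
  rw [← tsum_mul_left]
  exact tsum_congr fun n ↦ by ring

/-! ### Closed forms -/

/-- `Σ zⁿ Lⁿ/n! = e^{zL}`. [folklore] -/
theorem logSeries_pow (z L : ℝ) : logSeries (fun n ↦ z ^ n) L = Real.exp (z * L) := by
  have h : HasSum (fun n : ℕ ↦ (z * L) ^ n / n !) (Real.exp (z * L)) := by
    rw [Real.exp_eq_exp_ℝ]
    exact NormedSpace.expSeries_div_hasSum_exp (z * L)
  unfold logSeries
  rw [← h.tsum_eq]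
  exact tsum_congr fun n ↦ by rw [mul_pow]

/-- **`L · Σ_{n≥0} z^{n+1} Lⁿ/((n+1) n!) = e^{zL} − 1`**, i.e. `x log x · (d/dx) Li(x^z) = x^z − 1`
(BDR (2.5) for `Li`). [cite: BrouckeDebruyneRevesz2023, §2 (2.5)] -/
theorem mul_logSeries_pow_succ_div (z L : ℝ) :
    L * logSeries (fun n ↦ z ^ (n + 1) / (n + 1)) L = Real.exp (z * L) - 1 := by
  have h : HasSum (fun n : ℕ ↦ (z * L) ^ n / n !) (Real.exp (z * L)) := by
    rw [Real.exp_eq_exp_ℝ]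
    exact NormedSpace.expSeries_div_hasSum_exp (z * L)
  have h1 := (hasSum_nat_add_iff' 1).mpr h
  simp only [Finset.range_one, Finset.sum_singleton, pow_zero, Nat.factorial_zero, Nat.cast_one,
    div_one] at h1
  unfold logSeries
  rw [← tsum_mul_left, ← h1.tsum_eq]
  refine tsum_congr fun n ↦ ?_
  rw [Nat.factorial_succ, Nat.cast_mul, Nat.cast_add, Nat.cast_one, mul_pow, pow_succ, pow_succ]
  have hfac : (n ! : ℝ) ≠ 0 := by positivity
  have hn1 : (n : ℝ) + 1 ≠ 0 := by positivity
  field_simp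
  ring

/-- The geometric bound holds for `c n = zⁿ/n` (`c 0 = 0`): `|c n| ≤ |z|ⁿ`. [folklore] -/
theorem abs_pow_div_le (z : ℝ) (n : ℕ) : |(if n = 0 then (0 : ℝ) else z ^ n / n)| ≤ 1 * |z| ^ n := by
  rw [one_mul]
  split_ifs with h
  · simp
  · rw [abs_div, abs_pow, Nat.abs_cast]
    exact div_le_self (by positivity) (by exact_mod_cast Nat.one_le_iff_ne_zero.2 h)

end Literature.NumberTheory.BeurlingPrimes
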